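import Literature.Analysis.FunctionSpaces.SpinorWightmanPCTTheta
import HarnessLib

/-!
# Proof of the PCT theorem for spinor Wightman theories (`pct_theorem`)

Topic `Literature/Analysis/FunctionSpaces`. The discharge of the named fact
`Literature.Analysis.FunctionSpaces.pct_theorem` (`SpinorWightman`; Streater–Wightman (1964), §4-3,
Thm. 4-7, with the operator `Θ` of §3-4 Thm. 3-9):

* `Θ` from `IsSpinorWightmanQFT.exists_pctOperator` (`SpinorWightmanPCTTheta`): antiunitary,
  `Θ Ω = Ω`, `Θ D₀ ⊆ D₀`, `Θ U(a, A) = U(−a, A) Θ`;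
* `C k = SL2C.pctMatrix (S k)` (`SL2CPCTMatrix`): `C² = 1`, `C S(A) = S(A) C`, `S = 1 ⇒ C = 1`
  (`IsSpinorWightmanQFT.pct_matrices`);
* the PCT condition on the Wightman functions `IsSpinorWightmanQFT.wightmanFn_pct`
  (`SpinorWightmanPCTWightman`): the complex-boost/wedge-reflection identity
  (`TubeBoostPCT`, `SpinorWightmanPCTIdentity`) and the vanishing for an odd number of Fermi fields
  (`SpinorWightmanWrongParity`).

## References

* R. F. Streater, A. S. Wightman, *PCT, Spin and Statistics, and All That* (1964; Princeton 2000),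
  §3-4 Thm. 3-9, §4-3 Thm. 4-7. [StreaterWightman1964]
-/

noncomputable section

open scoped MatrixGroups
open Literature.MathematicalPhysics.QuantumLattice

namespace Literature.Analysis.FunctionSpaces

variable {κ : Type*} {W : SpinorWightmanData κ}

/-- **The PCT theorem for spinor Wightman theories** (Streater–Wightman (1964), §4-3, Thm. 4-7;
`Θ` as in §3-4 Thm. 3-9): discharge of `pct_theorem`. [cite: StreaterWightman1964, §4-3 Thm 4-7] -/
theorem pct_theorem_holds : pct_theorem (W := W) := by
  intro hW
  obtain ⟨Θ, h1, h2, h3⟩ := hW.exists_pctOperator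
  obtain ⟨c1, c2, c3⟩ := hW.pct_matrices
  exact ⟨Θ, h1, h2, h3, fun k => SL2C.pctMatrix (W.S k) (hW.continuous_S k), c1, c2, c3, hW.wightmanFn_pct⟩

end Literature.Analysis.FunctionSpaces
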